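import Summits.Ventures.PercRepro.RankLevelSetExplicitLin2KeyL

/-!
# PercRepro — THE LEVEL-14 THEOREM-M ROW OF C-025 OVER THE 5/8 RANGE: THE KEY AT `p = 10 623` (p9, S4; the key is p4's)

`proofs/SUBCLAIM-S4-p9.md` §S4.2⁗⁗. p4's THEOREM-M key `KeyL 14 p d` (RankLevelSetExplicitLin2KeyL) checked by the kernel at
`p = 10 623` on the coranks `15 ≤ d ≤ 10254` of THE 5/8 RANGE (`D' = 14 + 5·2^{11} = 10254`; the large-corank theorem
`c025_core_explicit_large_of58` takes the coranks beyond): `10 623` = the least `p` with the optimal Chernoff pair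
`16·n^n ≤ 2^n·(n − K)^{n−K}·K^K` at `n = p + D'`, `K = 14 + D'` (twin lean-drafts/p9/g7/twin/range58.py), at or above the key's
own floor and the bases `N₁ = 10 419`, `P₂ = 10 284` (RankLevelSetExplicitLin2Bases58); p4's sharp row sits at `16 856`
(RankLevelSetExplicitLin2IndepFloorS). The level step and the unconditional chain are RankLevelSetExplicitLin2IndepFloor58.
Axioms: standard (kernel `decide`).
-/

namespace PercRepro

namespace ThmN

namespace Explicit

/-- The THEOREM-M key row at `(q, p) = (14, 10 623)`, chunk 1 of 5: coranks `15 … 2062`, by the kernel. -/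
theorem key_fourteen_indep58_row_1 : ∀ t < 2048, KeyL 14 10623 (15 + t) := by decide +kernel

/-- The THEOREM-M key row at `(q, p) = (14, 10 623)`, chunk 2 of 5: coranks `2063 … 4110`, by the kernel. -/
theorem key_fourteen_indep58_row_2 : ∀ t < 2048, KeyL 14 10623 (15 + (2048 + t)) := by decide +kernel

/-- The THEOREM-M key row at `(q, p) = (14, 10 623)`, chunk 3 of 5: coranks `4111 … 6158`, by the kernel. -/
theorem key_fourteen_indep58_row_3 : ∀ t < 2048, KeyL 14 10623 (15 + (4096 + t)) := by decide +kernel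

/-- The THEOREM-M key row at `(q, p) = (14, 10 623)`, chunk 4 of 5: coranks `6159 … 8206`, by the kernel. -/
theorem key_fourteen_indep58_row_4 : ∀ t < 2048, KeyL 14 10623 (15 + (6144 + t)) := by decide +kernel

/-- The THEOREM-M key row at `(q, p) = (14, 10 623)`, chunk 5 of 5: coranks `8207 … 10254`, by the kernel. -/
theorem key_fourteen_indep58_row_5 : ∀ t < 2048, KeyL 14 10623 (15 + (8192 + t)) := by decide +kernel

/-- **THE THEOREM-M KEY ROW AT `(q, p) = (14, 10 623)` OVER THE 5/8 RANGE**: `KeyL 14 10623 d` at every corank `15 ≤ d ≤ 10254` (the 5 chunks). -/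
theorem key_fourteen_indep58_row : ∀ t < 10240, KeyL 14 10623 (15 + t) :=
  ball_lt_add (fun t => KeyL 14 10623 (15 + t)) 8192 2048
    (ball_lt_add (fun t => KeyL 14 10623 (15 + t)) 6144 2048
    (ball_lt_add (fun t => KeyL 14 10623 (15 + t)) 4096 2048
    (ball_lt_add (fun t => KeyL 14 10623 (15 + t)) 2048 2048
    key_fourteen_indep58_row_1 key_fourteen_indep58_row_2) key_fourteen_indep58_row_3) key_fourteen_indep58_row_4) key_fourteen_indep58_row_5

end Explicit

end ThmN

end PercRepro
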